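import Mathlib.MeasureTheory.Measure.SeparableMeasure
import Mathlib.MeasureTheory.Function.LocallyIntegrable
import Literature.Analysis.FluidPDE.VectorCalculus
import HarnessLib

/-!
# A countable family of divergence-free test fields, dense for the `L¹` norm of the gradient

Analysis/FluidPDE support file (all results proved; no definitions, no named facts).

Let `E` be a finite-dimensional real inner product space with its Lebesgue measure. The smooth,
compactly supported, divergence-free vector fields `φ : E → E` (the test fields of the duality
formulation of the Navier–Stokes equations, `FunctionSpaces.IsTestFunctionOn ⊤ φ` and
`VectorCalculus.IsDivFree φ`) contain a countable subfamily `Φ : ℕ → (E → E)` that is dense for the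
seminorm `φ ↦ ‖∇φ‖_{L¹} = ∫ ‖Dφ(x)‖ dx`:

* `exists_seq_divFree_tests_dense_fderiv` — for every divergence-free test field `φ` and every
  `ε > 0` there is an `n` with `∫ ‖Dφ − D(Φ n)‖ < ε`.

This is what one needs to test a bounded measurable field against ALL divergence-free test
fields using only countably many pairings `∫ ⟪w, ∂ₑ φₙ⟫` (the gauge-fixing step for bounded
ancient mild solutions in duality form, crux `TypeIliouvilleL`).

## Proof

No explicit construction: the map `φ ↦ [Dφ] ∈ L¹(E; E →L[ℝ] E)` sends the divergence-free test
fields into the Lebesgue space `Lp (E →L[ℝ] E) 1 volume`, which is second countable because the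
Lebesgue measure on `E` is separable (the Borel σ-algebra is countably generated and the measure
is σ-finite, `MeasureTheory.Lp.SecondCountableTopology`) and the finite-dimensional space
`E →L[ℝ] E` is separable. A subspace of a second-countable space is separable, so the image
admits a dense sequence; choosing preimages gives `Φ`, and the `L¹` distance of the classes of
two continuous compactly supported gradients is the Bochner integral `∫ ‖Dφ − Dψ‖`
(`MeasureTheory.L1.dist_eq_integral_dist`).

Auxiliary results: `integrable_fderiv_of_isTestFunctionOn` (the gradient of a test field is
integrable) and `VectorCalculus.isDivFree_zero` (the zero field is divergence free, so the
family is nonempty).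

## References

* L. C. Evans, *Partial Differential Equations*, 2nd ed. (AMS 2010), App. C.5 and §5.2.1
  (test functions, `C_c^∞` and `Lᵖ`); separability of `Lᵖ`, `1 ≤ p < ∞`, for a countably
  generated σ-finite measure: D. L. Cohn, *Measure Theory*, 2nd ed. (2013), Prop. 3.4.5. Folklore.
-/

noncomputable section

open MeasureTheory TopologicalSpace Set Filter
open scoped ENNReal Topology

namespace Literature.Analysis.FluidPDE

variable {E : Type*} [NormedAddCommGroup E] [InnerProductSpace ℝ E] [FiniteDimensional ℝ E]
  [MeasurableSpace E] [BorelSpace E]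

omit [FiniteDimensional ℝ E] [MeasurableSpace E] [BorelSpace E] in
/-- The zero vector field is divergence free: `div 0 = tr (D0) = tr 0 = 0`. [folklore] -/
theorem VectorCalculus.isDivFree_zero : VectorCalculus.IsDivFree (0 : E → E) := by
  intro x
  simp [VectorCalculus.divergence]

/-- The gradient `Dφ` of a test field (smooth, compactly supported) is integrable: it is continuous
with compact support (Evans, *PDE*, App. C.5). [folklore] -/
theorem integrable_fderiv_of_isTestFunctionOn {φ : E → E}
    (hφ : FunctionSpaces.IsTestFunctionOn (⊤ : Opens E) φ) :
    Integrable (fderiv ℝ φ) (volume : Measure E) :=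
  (hφ.contDiff.continuous_fderiv (by simp)).integrable_of_hasCompactSupport
    (hφ.hasCompactSupport.fderiv (𝕜 := ℝ))

/-- **Countable family of divergence-free test fields, dense for the `L¹` norm of the gradient.**
On a finite-dimensional real inner product space `E` there is a sequence `Φ : ℕ → (E → E)` of
smooth, compactly supported, divergence-free vector fields such that every smooth, compactly
supported, divergence-free `φ` is approximated in the seminorm `∫ ‖Dφ − D(Φ n)‖`: for every `ε > 0`
some `n` has `∫ ‖Dφ(x) − D(Φ n)(x)‖ dx < ε`. (Separability of `L¹(E; E →L[ℝ] E)` for the Lebesgue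
measure, Cohn, *Measure Theory*, Prop. 3.4.5, restricted to the image of the divergence-free test
fields under `φ ↦ Dφ`; Evans, *PDE*, App. C.5.) [folklore] -/
theorem exists_seq_divFree_tests_dense_fderiv :
    ∃ Φ : ℕ → (E → E),
      (∀ n, FunctionSpaces.IsTestFunctionOn (⊤ : Opens E) (Φ n)) ∧
      (∀ n, VectorCalculus.IsDivFree (Φ n)) ∧
      ∀ φ : E → E, FunctionSpaces.IsTestFunctionOn (⊤ : Opens E) φ → VectorCalculus.IsDivFree φ →
        ∀ ε : ℝ, 0 < ε → ∃ n, ∫ x, ‖fderiv ℝ φ x - fderiv ℝ (Φ n) x‖ < ε := by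
  classical
  -- the admissible fields and the map `φ ↦ [Dφ]` into `L¹(E; E →L[ℝ] E)`
  let T : Set (E → E) :=
    {φ | FunctionSpaces.IsTestFunctionOn (⊤ : Opens E) φ ∧ VectorCalculus.IsDivFree φ}
  let ι : T → Lp (E →L[ℝ] E) 1 (volume : Measure E) := fun φ =>
    (integrable_fderiv_of_isTestFunctionOn φ.2.1).toL1 (fderiv ℝ (φ : E → E))
  have h0 : (0 : E → E) ∈ T :=
    ⟨FunctionSpaces.isTestFunctionOn_zero _, VectorCalculus.isDivFree_zero⟩
  -- `L¹(E; E →L[ℝ] E)` is second countable, hence so is the range of `ι`, which is then separable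
  haveI : Fact ((1 : ℝ≥0∞) ≤ 1) := ⟨le_rfl⟩
  haveI : Fact ((1 : ℝ≥0∞) ≠ ∞) := ⟨ENNReal.one_ne_top⟩
  haveI : SecondCountableTopology (Lp (E →L[ℝ] E) 1 (volume : Measure E)) := inferInstance
  haveI : Nonempty (range ι) := ⟨⟨ι ⟨0, h0⟩, mem_range_self _⟩⟩
  obtain ⟨u, hu⟩ := TopologicalSpace.exists_dense_seq (range ι)
  -- choose preimages
  choose ψ hψ using fun n => (u n).2
  refine ⟨fun n => (ψ n : E → E), fun n => (ψ n).2.1, fun n => (ψ n).2.2, ?_⟩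
  intro φ hφ hdiv ε hε
  obtain ⟨n, hn⟩ := hu.exists_dist_lt ⟨ι ⟨φ, hφ, hdiv⟩, mem_range_self _⟩ hε
  refine ⟨n, ?_⟩
  rw [Subtype.dist_eq, ← hψ n, L1.dist_eq_integral_dist] at hn
  -- the `L¹` distance of the classes is the integral of the pointwise distance of the gradients
  have hae : (fun x => dist (ι ⟨φ, hφ, hdiv⟩ x) (ι (ψ n) x)) =ᵐ[volume]
      fun x => ‖fderiv ℝ φ x - fderiv ℝ (ψ n : E → E) x‖ := by
    filter_upwards [(integrable_fderiv_of_isTestFunctionOn hφ).coeFn_toL1,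
      (integrable_fderiv_of_isTestFunctionOn (ψ n).2.1).coeFn_toL1] with x hx hy
    rw [dist_eq_norm]
    exact congrArg₂ (fun a b => ‖a - b‖) hx hy
  rwa [integral_congr_ae hae] at hn

end Literature.Analysis.FluidPDE
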